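import Summits.KontsevichZagierPeriods.Zeta5Search.LaiSweepShard

/-!
# `κ₃` sweep certificate — shard file 021 of 127 (shards 147–153 of 889)

HONEST FRAMING. Systematic search; no irrationality claim unless certified. This file only checks,
by `decide +kernel`, shards 147–153 of the order-cell sweep of the `κ₃` point `(74, 2180, 444; δ74)`
(engine `LaiSweepEngine`, soundness `LaiSweepJump/Free/Eval/Shard/Kappa3`; a shard is `⟨regime, n,
p, q, p', q', Lo, Up⟩`: `n` cells from `p/q` to `p'/q'` with integer rate sums in `[Lo, Up]`, `K =
128`, `D = 2^40`). It draws NO conclusion: only the capstone `LaiKappa3SweepCert`, which needs all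
127 shard files, does. Kernel cost of this file ≈ 560 cells × 0.3 s.
-/

namespace Summit.KontsevichZagierPeriods.Zeta5Search.Sweep

set_option maxHeartbeats 100000000 in
/-- Shard 147: 80 cells of regime B from `23/344` to `23/338`.
[cite: Lai2024BallRivoal, §4 Lemma 4.3] -/
theorem shard147 :
    Shard.check 128 (2^40)
      ⟨true, 80, 23, 344, 23, 338, 93835975042468, 94078891852094⟩ = true := by
  decide +kernel

set_option maxHeartbeats 100000000 in
/-- Shard 148: 80 cells of regime B from `23/338` to `30/433`.
[cite: Lai2024BallRivoal, §4 Lemma 4.3] -/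
theorem shard148 :
    Shard.check 128 (2^40)
      ⟨true, 80, 23, 338, 30, 433, 95616696752650, 95882560184799⟩ = true := by
  decide +kernel

set_option maxHeartbeats 100000000 in
/-- Shard 149: 80 cells of regime B from `30/433` to `23/326`.
[cite: Lai2024BallRivoal, §4 Lemma 4.3] -/
theorem shard149 :
    Shard.check 128 (2^40)
      ⟨true, 80, 30, 433, 23, 326, 96088879429900, 96358429092960⟩ = true := by
  decide +kernel

set_option maxHeartbeats 100000000 in
/-- Shard 150: 80 cells of regime B from `23/326` to `345/4804`.
[cite: Lai2024BallRivoal, §4 Lemma 4.3] -/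
theorem shard150 :
    Shard.check 128 (2^40)
      ⟨true, 80, 23, 326, 345, 4804, 93561256496604, 93867581049226⟩ = true := by
  decide +kernel

set_option maxHeartbeats 100000000 in
/-- Shard 151: 80 cells of regime B from `345/4804` to `29/397`.
[cite: Lai2024BallRivoal, §4 Lemma 4.3] -/
theorem shard151 :
    Shard.check 128 (2^40)
      ⟨true, 80, 345, 4804, 29, 397, 89878743679839, 90147071347428⟩ = true := by
  decide +kernel

set_option maxHeartbeats 100000000 in
/-- Shard 152: 80 cells of regime B from `29/397` to `13/175`.
[cite: Lai2024BallRivoal, §4 Lemma 4.3] -/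
theorem shard152 :
    Shard.check 128 (2^40)
      ⟨true, 80, 29, 397, 13, 175, 88883977214856, 89167327642104⟩ = true := by
  decide +kernel

set_option maxHeartbeats 100000000 in
/-- Shard 153: 80 cells of regime B from `13/175` to `21/278`.
[cite: Lai2024BallRivoal, §4 Lemma 4.3] -/
theorem shard153 :
    Shard.check 128 (2^40)
      ⟨true, 80, 13, 175, 21, 278, 88356786020400, 88643193534595⟩ = true := by
  decide +kernel

/-- The checked shards of this file, in order. [folklore] -/
def shards021 : List (CheckedShard 128 (2^40)) :=
  [⟨_, shard147⟩, ⟨_, shard148⟩, ⟨_, shard149⟩, ⟨_, shard150⟩, ⟨_, shard151⟩,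
    ⟨_, shard152⟩, ⟨_, shard153⟩]

end Summit.KontsevichZagierPeriods.Zeta5Search.Sweep
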